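import Mathlib
import Literature.Analysis.UnboundedOperators.HeatExtensionDecay

/-!
# Crux `SlicedKelvin.PlanarFluxAPriori` (stmt-NavierStokesRegularity-15600), line `registered`,
# stub `stub_decayPersistence` — the caloric extension keeps the cubic weight

Support file (theorems only) for the decay-persistence stub of the crux `PlanarFluxAPriori`
(Brandolese 2004; Kukavica–Torres 2006: space decay of strong solutions from decaying data):
the free (caloric) term of the Oseen formulation keeps the cubic spatial weight,

* `decay_weighted_heatExtension_le` —
  `(1 + |x|)³ |e^{sΔ} f (x)| ≤ C_G (1 + s^{3/2}) sup_y (1 + |y|)³ |f(y)|`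

(near field `|x| ≤ 2|x - y|`: `(1+|x|)³ ≤ 8(1+|x-y|)³` and the kernel has mass one; far field:
the Gaussian tail `G_s(y) ≤ (4πs)^{-3/2} e^{-|x|²/(16 s)}` on the ball `|y - x| < |x|/2` and
`u³ e^{-u} ≤ 6`). The companion Oseen-kernel estimate is `…DecayKernelWeights.lean`.

## References

* L. Brandolese, *Space-time decay of Navier–Stokes flows invariant under rotations*,
  Math. Ann. 329 (2004) = arXiv:math/0403136.
* I. Kukavica, J. J. Torres, *Weighted bounds for the velocity and the vorticity for the
  Navier–Stokes equations*, Nonlinearity 19 (2006).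
-/

noncomputable section

-- the summit and its single sub-problem share the name (CONVENTIONS §1), as in every Theorems file
set_option linter.dupNamespace false

namespace Summit.NavierStokesRegularity.NavierStokesRegularity.Theorems.SlicedKelvinPlanarFluxAPriori

open MeasureTheory Set Filter Topology Metric Real
open scoped ENNReal NNReal
open Literature.Analysis.UnboundedOperators

/-! ### The caloric extension keeps the cubic weight -/

/-- Elementary: `u³ e^{-u} ≤ 6` for `u ≥ 0`. -/
theorem decay_cube_mul_exp_neg_le {u : ℝ} (hu : 0 ≤ u) : u ^ 3 * Real.exp (-u) ≤ 6 := by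
  have h := pow_mul_exp_neg_le_factorial hu 3
  have h6 : ((Nat.factorial 3 : ℕ) : ℝ) = 6 := by norm_num [Nat.factorial]
  rwa [h6] at h

/-- **The caloric extension keeps the cubic weight**: there is an absolute `C_G > 0` such that
for every continuous `f : ℝ³ → F` with `(1 + |y|)³ ‖f y‖ ≤ A` and every `s > 0`,
`(1 + |x|)³ ‖e^{sΔ} f (x)‖ ≤ C_G (1 + s^{3/2}) A` (near field: `(1+|x|)³ ≤ 8 (1+|x-y|)³` when
`|x| ≤ 2|x - y|`; far field: the Gaussian tail `G_s(y) ≤ (4πs)^{-3/2} e^{-|x|²/(16 s)}` on the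
ball `|y - x| < |x|/2`, and `u³e^{-u} ≤ 6`). -/
theorem decay_weighted_heatExtension_le :
    ∃ C_G : ℝ, 0 < C_G ∧ ∀ {F : Type} [NormedAddCommGroup F] [NormedSpace ℝ F]
      ⦃s : ℝ⦄, 0 < s → ∀ {f : EuclideanSpace ℝ (Fin 3) → F}, Continuous f → ∀ {A : ℝ},
      (∀ y, (1 + ‖y‖) ^ 3 * ‖f y‖ ≤ A) → ∀ x : EuclideanSpace ℝ (Fin 3),
        (1 + ‖x‖) ^ 3 * ‖Literature.Analysis.UnboundedOperators.heatExtension f s x‖ ≤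
          C_G * (1 + s ^ (3 / 2 : ℝ)) * A := by
  -- the far-field constant
  set c₀ : ℝ := (4 * π) ^ (-(3 : ℝ) / 2) with hc₀
  have hc₀0 : 0 < c₀ := Real.rpow_pos_of_pos (by positivity) _
  set C_far : ℝ := (π * 4 / 3) * c₀ * 6 * 16 ^ 3 with hCfar
  have hCfar0 : 0 < C_far := by positivity
  refine ⟨8 + C_far, by positivity, ?_⟩
  intro F _ _ s hs f hf A hA x
  have hfin : (Module.finrank ℝ (EuclideanSpace ℝ (Fin 3)) : ℝ) = 3 := by
    rw [finrank_euclideanSpace_fin]; norm_num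
  have hA0 : 0 ≤ A := by
    have h0 := hA 0
    have h1 : 0 ≤ (1 + ‖(0 : EuclideanSpace ℝ (Fin 3))‖) ^ 3 * ‖f 0‖ := by positivity
    linarith
  -- `f` is bounded by `A`
  have hfA : ∀ y, ‖f y‖ ≤ A := fun y => by
    have h1 : 1 ≤ (1 + ‖y‖) ^ 3 := one_le_pow₀ (by linarith [norm_nonneg y])
    have := hA y
    nlinarith [norm_nonneg (f y)]
  have hGpos : ∀ y : EuclideanSpace ℝ (Fin 3), 0 < heatKernel s y := fun y => heatKernel_pos hs y
  have hint1 : Integrable (fun y : EuclideanSpace ℝ (Fin 3) => heatKernel s y * A) :=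
    (integrable_heatKernel_holds hs).mul_const A
  have hmass : ∫ y : EuclideanSpace ℝ (Fin 3), heatKernel s y = 1 := integral_heatKernel_eq_one_holds hs
  have hs32' : 0 ≤ s ^ (3 / 2 : ℝ) := Real.rpow_nonneg hs.le _
  rcases lt_or_ge ‖x‖ 1 with hx1 | hx1
  · -- `|x| < 1`
    have h1 : ‖heatExtension f s x‖ ≤ A := norm_heatExtension_le_of_bound hfA hs x
    have h2 : (1 + ‖x‖) ^ 3 ≤ 8 := by
      calc (1 + ‖x‖) ^ 3 ≤ 2 ^ 3 := pow_le_pow_left₀ (by positivity) (by linarith) 3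
        _ = 8 := by norm_num
    calc (1 + ‖x‖) ^ 3 * ‖heatExtension f s x‖ ≤ 8 * A :=
          mul_le_mul h2 h1 (norm_nonneg _) (by norm_num)
      _ ≤ (8 + C_far) * (1 + s ^ (3 / 2 : ℝ)) * A := by
          refine mul_le_mul_of_nonneg_right ?_ hA0
          nlinarith
  · -- `|x| ≥ 1`: split the integrand
    have hx0 : 0 < ‖x‖ := lt_of_lt_of_le one_pos hx1
    set ρ : ℝ := ‖x‖ / 2 with hρ
    have hρ0 : 0 < ρ := by positivity
    set Bx : Set (EuclideanSpace ℝ (Fin 3)) := ball x ρ with hBx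
    set σ : ℝ := s ^ (3 / 2 : ℝ) with hσ
    have hσ0 : 0 < σ := Real.rpow_pos_of_pos hs _
    set u : ℝ := ‖x‖ ^ 2 / (16 * s) with hu
    have hu0 : 0 < u := by positivity
    set g : ℝ := c₀ * σ⁻¹ * Real.exp (-u) with hg
    have hg0 : 0 ≤ g := by positivity
    -- the Gaussian normalisation in dimension three
    have hnorm : (4 * π * s) ^ (-(Module.finrank ℝ (EuclideanSpace ℝ (Fin 3)) : ℝ) / 2) =
        c₀ * σ⁻¹ := by
      rw [hfin, hc₀, hσ, ← Real.rpow_neg hs.le, Real.mul_rpow (x := 4 * π) (y := s) (by positivity) hs.le]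
      congr 1
      norm_num
    have hpt : ∀ y, (1 + ‖x‖) ^ 3 * ‖heatKernel s y • f (x - y)‖ ≤
        8 * (heatKernel s y * A) + Bx.indicator (fun _ => (1 + ‖x‖) ^ 3 * g * A) y := by
      intro y
      rw [norm_smul, Real.norm_of_nonneg (hGpos y).le]
      rcases le_or_gt ‖x‖ (2 * ‖x - y‖) with hnear | hfar
      · -- near field: `(1 + |x|)³ ‖f(x - y)‖ ≤ 8 A`
        have h1 : (1 + ‖x‖) ^ 3 * ‖f (x - y)‖ ≤ 8 * A := by
          have h2 : (1 + ‖x‖) ^ 3 ≤ 8 * (1 + ‖x - y‖) ^ 3 := by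
            have h3 : 1 + ‖x‖ ≤ 2 * (1 + ‖x - y‖) := by linarith
            calc (1 + ‖x‖) ^ 3 ≤ (2 * (1 + ‖x - y‖)) ^ 3 := pow_le_pow_left₀ (by positivity) h3 3
              _ = 8 * (1 + ‖x - y‖) ^ 3 := by ring
          calc (1 + ‖x‖) ^ 3 * ‖f (x - y)‖ ≤ 8 * (1 + ‖x - y‖) ^ 3 * ‖f (x - y)‖ :=
                mul_le_mul_of_nonneg_right h2 (norm_nonneg _)
            _ = 8 * ((1 + ‖x - y‖) ^ 3 * ‖f (x - y)‖) := by ring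
            _ ≤ 8 * A := by linarith [hA (x - y)]
        calc (1 + ‖x‖) ^ 3 * (heatKernel s y * ‖f (x - y)‖)
            = heatKernel s y * ((1 + ‖x‖) ^ 3 * ‖f (x - y)‖) := by ring
          _ ≤ heatKernel s y * (8 * A) := mul_le_mul_of_nonneg_left h1 (hGpos y).le
          _ = 8 * (heatKernel s y * A) := by ring
          _ ≤ 8 * (heatKernel s y * A) + Bx.indicator (fun _ => (1 + ‖x‖) ^ 3 * g * A) y :=
              le_add_of_nonneg_right (indicator_nonneg (fun _ _ => by positivity) _)
      · -- far field: `y ∈ B(x, |x|/2)`, Gaussian tail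
        have hyB : y ∈ Bx := by
          rw [hBx, mem_ball, dist_eq_norm, norm_sub_rev, hρ]; linarith
        have hxy2 : ‖x‖ ≤ 2 * ‖y‖ := by
          have h' : ‖x‖ - ‖y‖ ≤ ‖x - y‖ := norm_sub_norm_le x y
          linarith
        have hG : heatKernel s y ≤ g := by
          have h := heatKernel_le_exp_of_norm_le_two_mul hs hxy2
          rw [hnorm] at h
          have hexp : Real.exp (-‖x‖ ^ 2 / (16 * s)) = Real.exp (-u) := by rw [hu, neg_div]
          rw [hexp] at h
          exact h
        have h1 : (1 + ‖x‖) ^ 3 * (heatKernel s y * ‖f (x - y)‖) ≤ (1 + ‖x‖) ^ 3 * g * A := by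
          calc (1 + ‖x‖) ^ 3 * (heatKernel s y * ‖f (x - y)‖)
              ≤ (1 + ‖x‖) ^ 3 * (g * A) := by
                refine mul_le_mul_of_nonneg_left ?_ (by positivity)
                exact mul_le_mul hG (hfA _) (norm_nonneg _) hg0
            _ = (1 + ‖x‖) ^ 3 * g * A := by ring
        calc (1 + ‖x‖) ^ 3 * (heatKernel s y * ‖f (x - y)‖)
            ≤ (1 + ‖x‖) ^ 3 * g * A := h1
          _ = Bx.indicator (fun _ => (1 + ‖x‖) ^ 3 * g * A) y := by rw [indicator_of_mem hyB]
          _ ≤ 8 * (heatKernel s y * A) + Bx.indicator (fun _ => (1 + ‖x‖) ^ 3 * g * A) y :=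
              le_add_of_nonneg_left (by have := hGpos y; positivity)
    -- integrate the domination
    have hind : Integrable (fun y => Bx.indicator (fun _ => (1 + ‖x‖) ^ 3 * g * A) y)
        (volume : Measure (EuclideanSpace ℝ (Fin 3))) :=
      (integrableOn_const (measure_ball_lt_top.ne)).integrable_indicator measurableSet_ball
    have hint2 : Integrable (fun y => 8 * (heatKernel s y * A) +
        Bx.indicator (fun _ => (1 + ‖x‖) ^ 3 * g * A) y) := (hint1.const_mul 8).add hind
    have hvolB : (volume : Measure (EuclideanSpace ℝ (Fin 3))).real Bx = ρ ^ 3 * (π * 4 / 3) := by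
      rw [measureReal_def, hBx, EuclideanSpace.volume_ball_fin_three, ENNReal.toReal_mul,
        ← ENNReal.ofReal_pow hρ0.le, ENNReal.toReal_ofReal (by positivity),
        ENNReal.toReal_ofReal (by positivity)]
    have hmain : (1 + ‖x‖) ^ 3 * ‖heatExtension f s x‖ ≤
        8 * A + (1 + ‖x‖) ^ 3 * g * A * (ρ ^ 3 * (π * 4 / 3)) := by
      rw [heatExtension_apply]
      calc (1 + ‖x‖) ^ 3 * ‖∫ y, heatKernel s y • f (x - y)‖
          ≤ (1 + ‖x‖) ^ 3 * ∫ y, ‖heatKernel s y • f (x - y)‖ :=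
            mul_le_mul_of_nonneg_left (norm_integral_le_integral_norm _) (by positivity)
        _ = ∫ y, (1 + ‖x‖) ^ 3 * ‖heatKernel s y • f (x - y)‖ := (integral_const_mul _ _).symm
        _ ≤ ∫ y, (8 * (heatKernel s y * A) + Bx.indicator (fun _ => (1 + ‖x‖) ^ 3 * g * A) y) :=
            integral_mono_of_nonneg (Eventually.of_forall fun y => by positivity) hint2
              (Eventually.of_forall hpt)
        _ = 8 * A + (1 + ‖x‖) ^ 3 * g * A * (ρ ^ 3 * (π * 4 / 3)) := by
            rw [integral_add (hint1.const_mul 8) hind, integral_const_mul, integral_mul_const, hmass,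
              one_mul, integral_indicator measurableSet_ball, setIntegral_const, hvolB, smul_eq_mul]
            ring
    -- the far-field term is at most `C_far σ A`
    have hfar : (1 + ‖x‖) ^ 3 * g * A * (ρ ^ 3 * (π * 4 / 3)) ≤ C_far * σ * A := by
      -- `σ² = s³` and `u³ = |x|⁶ / (16³ σ²)`
      have hσ2 : σ ^ 2 = s ^ 3 := by
        rw [hσ, ← Real.rpow_natCast, ← Real.rpow_mul hs.le]
        norm_num
      have hu3 : u ^ 3 = ‖x‖ ^ 6 / (16 ^ 3 * σ ^ 2) := by
        rw [hu, hσ2]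
        field_simp
      -- `e^{-u} ≤ 6 u⁻³`
      have hexp : Real.exp (-u) ≤ 6 * (16 ^ 3 * σ ^ 2) / ‖x‖ ^ 6 := by
        have h1 : Real.exp (-u) ≤ 6 / u ^ 3 := by
          rw [le_div_iff₀ (by positivity), mul_comm]
          exact decay_cube_mul_exp_neg_le hu0.le
        rw [hu3] at h1
        refine h1.trans (le_of_eq ?_)
        field_simp
      have hkey : (1 + ‖x‖) ^ 3 * g * (ρ ^ 3 * (π * 4 / 3)) ≤ C_far * σ := by
        have h1 : (1 + ‖x‖) ^ 3 * g * (ρ ^ 3 * (π * 4 / 3)) ≤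
            (1 + ‖x‖) ^ 3 * (c₀ * σ⁻¹ * (6 * (16 ^ 3 * σ ^ 2) / ‖x‖ ^ 6)) * (ρ ^ 3 * (π * 4 / 3)) := by
          rw [hg]
          gcongr
        refine h1.trans ?_
        have h2 : (1 + ‖x‖) ^ 3 * (c₀ * σ⁻¹ * (6 * (16 ^ 3 * σ ^ 2) / ‖x‖ ^ 6)) * (ρ ^ 3 * (π * 4 / 3)) =
            C_far * σ * (((1 + ‖x‖) / ‖x‖) ^ 3 / 8) := by
          rw [hCfar, hρ]
          field_simp
          ring
        rw [h2]
        have h3 : (1 + ‖x‖) / ‖x‖ ≤ 2 := by rw [div_le_iff₀ hx0]; linarith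
        have h4 : ((1 + ‖x‖) / ‖x‖) ^ 3 / 8 ≤ 1 := by
          rw [div_le_one (by norm_num)]
          calc ((1 + ‖x‖) / ‖x‖) ^ 3 ≤ 2 ^ 3 := pow_le_pow_left₀ (by positivity) h3 3
            _ = 8 := by norm_num
        calc C_far * σ * (((1 + ‖x‖) / ‖x‖) ^ 3 / 8)
            ≤ C_far * σ * 1 := mul_le_mul_of_nonneg_left h4 (by positivity)
          _ = C_far * σ := mul_one _
      calc (1 + ‖x‖) ^ 3 * g * A * (ρ ^ 3 * (π * 4 / 3))
          = ((1 + ‖x‖) ^ 3 * g * (ρ ^ 3 * (π * 4 / 3))) * A := by ring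
        _ ≤ (C_far * σ) * A := mul_le_mul_of_nonneg_right hkey hA0
        _ = C_far * σ * A := by ring
    calc (1 + ‖x‖) ^ 3 * ‖heatExtension f s x‖
        ≤ 8 * A + (1 + ‖x‖) ^ 3 * g * A * (ρ ^ 3 * (π * 4 / 3)) := hmain
      _ ≤ 8 * A + C_far * σ * A := by linarith
      _ ≤ (8 + C_far) * (1 + σ) * A := by nlinarith

end Summit.NavierStokesRegularity.NavierStokesRegularity.Theorems.SlicedKelvinPlanarFluxAPriori

end
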